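import Literature.Analysis.UnboundedOperators.HeatExtensionUniformTail
import Literature.Analysis.UnboundedOperators.HeatExtensionJointSmooth
import Literature.Analysis.UnboundedOperators.HeatKernelHeatEquation
import Literature.Analysis.UnboundedOperators.HeatKernelGaussianData
import Literature.Analysis.FunctionSpaces.WeakLpSplit
import Literature.Analysis.FluidPDE.KochTataruIntegralOfClass
import Literature.Analysis.FluidPDE.NSBoundedMildOseenClassical
import HarnessLib

/-!
# The caloric extension of weak-`Lᵖ` data: smoothness, heat equation, divergence, `L^q` bounds,
# uniform tails

Analysis/FluidPDE support file (theorems only) for the discharge of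
`Literature.Analysis.FluidPDE.bradshawTsai2017_lemma_3_4` (`PeriodicLeraySystem.lean`;
Bradshaw–Tsai, *Forward discretely self-similar solutions of the Navier–Stokes equations II*,
Ann. Henri Poincaré 18 (2017) [BT1], Lemma 3.4 with Lemma 3.2). For a datum `f` in weak `Lᵖ`,
`1 < p < ∞` (the case of [BT1] is `p = 3` on `ℝ³`), the caloric extension
`V(t) = e^{tΔ}f = heatKernel t ⋆ f` (`UnboundedOperators.heatExtension`) is studied through the
truncation at height one of a strongly measurable representative,
`f = g + h` a.e., `g = f𝟙_{|f|>1} ∈ L¹`, `h = f𝟙_{|f|≤1} ∈ L^r` for every `r ∈ (p, ∞)`, `|h| ≤ 1`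
(`WeakLpSplit.lean`; the organisation of `CaloricLocalLerayHolds.lean`), and the `Lᵖ` theory of
the heat kernel of the `UnboundedOperators` trunk applied to each piece:

* `MemWeakLp.exists_integrable_add_bounded` — the truncation; `MemWeakLp.isPolynomiallyTempered`
  — weak-`Lᵖ` fields are polynomially tempered.
* `heatExtension_eq_add_of_ae_eq_add` — `e^{tΔ}f = e^{tΔ}g + e^{tΔ}h` on `t > 0`.
* `MemWeakLp.contDiffOn_heatExtension_prod`, `MemWeakLp.contDiff_heatExtension` — `V` is jointly
  `C^∞` on `(0,∞) × E` and every slice is `C^∞` ("the smoothing effect of the heat kernel",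
  [BT1] proof of Lemma 3.4).
* `MemWeakLp.hasDerivAt_heatExtension_time` — the heat equation `∂ₜV = ΔV` pointwise on `t > 0`.
* `MemWeakLp.isDivFree_heatExtension` — for weakly divergence-free data every slice `V(t)`,
  `t > 0`, is (classically) divergence free ([BT1]: "`e^{tΔ}v₀` is the divergence free …
  solution to the heat equation").
* `MemWeakLp.exists_forall_eLpNorm_heatExtension_le` — `sup_{t ≥ t₀} ‖V(t)‖_{L^q} < ∞` for every
  `q ∈ (p, ∞]` ([BT1] Lemma 3.4: "`U₀ ∈ L^∞(0,T; L^q(ℝ³))`").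
* `MemWeakLp.exists_forall_eLpNorm_heatExtension_restrict_compl_ball_le` — **[BT1] Lemma 3.2**
  for weak-`Lᵖ` data: `sup_{t ∈ [t₀,t₁]} ‖V(t)‖_{L^q(|x| ≥ R)} → 0` as `R → ∞`, `q ∈ (p, ∞]`.

[BT1] prove Lemma 3.2 for *discretely self-similar* data via Lemma 3.1
(`L³_w = L³_loc(ℝ³∖{0})` for DSS fields) and a decomposition into dyadic shells; the truncation
route used here needs neither self-similarity nor Lemma 3.1 and gives the statement for all
weak-`Lᵖ` data (the uniform-in-time tail lemma for `Lᵖ` pieces is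
`UnboundedOperators.exists_forall_eLpNorm_heatExtension_restrict_compl_ball_le`).

## Mathlib / tree search

Reused: `MemWeakLp.integrable_indicator_one_lt_norm`, `MemWeakLp.memLp_indicator_norm_le_one`
(`WeakLpSplit.lean`); `heatExtension_congr_ae'` (`HeatKernelGaussianData.lean`);
`contDiffOn_heatExtension_prod` (`HeatExtensionJointSmooth.lean`); `contDiff_heatExtension_holds`;
`hasDerivAt_heatExtension_time` (`HeatKernelHeatEquation.lean`);
`eLpNorm_heatExtension_le_rpow_holds`; `isWeaklyDivFree_heatExtension`,
`integrable_inv_one_add_norm_sq_pow_finrank_succ` (`KochTataruIntegralOfClass.lean`);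
`IsWeaklyDivFree.isDivFree_of_contDiff` (`NSBoundedMildOseenClassical.lean`). No prior statement
for weak-`Lᵖ` data (`lean search 'MemWeakLp.*heatExtension'`: none). Mathlib:
`ConvolutionExistsAt.distrib_add`, `ContDiffAt.laplacian_add`, `HasDerivAt.congr_of_eventuallyEq`.

## References

* Z. Bradshaw, T.-P. Tsai, Ann. Henri Poincaré 18 (2017) 1095–1119 = arXiv:1510.07504,
  Lemma 3.2 and Lemma 3.4 (proof) [BradshawTsai2017AHP].
* P. G. Lemarié-Rieusset, *The Navier–Stokes problem in the 21st century*, CRC Press 2016,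
  Cor. 6.2 (divergence of the free evolution) [LemarieRieusset2016].
-/

noncomputable section

open MeasureTheory Set Function Filter Metric TopologicalSpace
open _root_.Topology
open scoped NNReal ENNReal Laplacian Convolution

namespace Literature.Analysis.FluidPDE

open UnboundedOperators FunctionSpaces

variable {E : Type*} [NormedAddCommGroup E] [InnerProductSpace ℝ E] [FiniteDimensional ℝ E]
  [MeasurableSpace E] [BorelSpace E]
variable {F : Type*} [NormedAddCommGroup F] [NormedSpace ℝ F]

/-! ### Truncation of weak-`Lᵖ` data at height one -/

omit [NormedSpace ℝ F] in
/-- **Truncation at height one** (`L^p_w ⊂ L¹ + (L^r ∩ L^∞)`, `1 < p < r < ∞`): a weak-`Lᵖ`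
field `f` agrees a.e. with `g + h`, where `g = f'𝟙_{|f'|>1}` is integrable and
`h = f'𝟙_{|f'|≤1}` is bounded by `1` and lies in `L^r` for every finite `r > p` (`f'` a strongly
measurable representative; [BT1] use instead `L³_w ∩ DSS ⊂ L³_loc(ℝ³∖{0})`, Lemma 3.1). [cite: BradshawTsai2017AHP, Lemma 3.1–3.2] -/
theorem _root_.Literature.Analysis.FunctionSpaces.MemWeakLp.exists_integrable_add_bounded
    {f : E → F} {p : ℝ≥0∞}
    (hf : MemWeakLp f p volume) (hp1 : 1 < p) (hp : p ≠ ∞) :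
    ∃ g h : E → F, f =ᵐ[volume] g + h ∧ Integrable g ∧
      (∀ r : ℝ≥0∞, p < r → r ≠ ∞ → MemLp h r volume) ∧ ∀ z, ‖h z‖ ≤ 1 := by
  set f' := hf.aestronglyMeasurable.mk f with hf'_def
  have hmeas : StronglyMeasurable f' := hf.aestronglyMeasurable.stronglyMeasurable_mk
  have hae : f =ᵐ[volume] f' := hf.aestronglyMeasurable.ae_eq_mk
  have hw : MemWeakLp f' p volume := hf.congr_ae hae
  refine ⟨{x | 1 < ‖f' x‖}.indicator f', {x | ‖f' x‖ ≤ 1}.indicator f', ?_,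
    hw.integrable_indicator_one_lt_norm hmeas hp hp1,
    fun r hpr hr => hw.memLp_indicator_norm_le_one hmeas hpr hr,
    norm_indicator_norm_le_one_le f'⟩
  rw [indicator_one_lt_norm_add_indicator_norm_le_one]
  exact hae

/-- **Weak-`Lᵖ` fields are polynomially tempered** (`1 < p < ∞`): both pieces of the truncation
are integrable against the weight `(1 + ‖y‖²)^{-(d+1)} ∈ L¹ ∩ L^∞`. [folklore] -/
theorem _root_.Literature.Analysis.FunctionSpaces.MemWeakLp.isPolynomiallyTempered {f : E → E}
    {p : ℝ≥0∞} (hf : MemWeakLp f p volume) (hp1 : 1 < p) (hp : p ≠ ∞) :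
    IsPolynomiallyTempered f := by
  obtain ⟨g, h, hfgh, hg, hh, hh1⟩ := hf.exists_integrable_add_bounded hp1 hp
  have hw := integrable_inv_one_add_norm_sq_pow_finrank_succ (E := E)
  set N : ℕ := Module.finrank ℝ E + 1 with hN
  have hw0 : ∀ y : E, 0 ≤ ((1 + ‖y‖ ^ 2) ^ N : ℝ)⁻¹ := fun y => by positivity
  have hwle : ∀ y : E, ((1 + ‖y‖ ^ 2) ^ N : ℝ)⁻¹ ≤ 1 := fun y =>
    inv_le_one_of_one_le₀ (one_le_pow₀ (by nlinarith [norm_nonneg y]))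
  have hr : MemLp h (p + 1) volume :=
    hh (p + 1) (ENNReal.lt_add_right hp one_ne_zero) (ENNReal.add_ne_top.2 ⟨hp, ENNReal.one_ne_top⟩)
  have h1 : Integrable (fun y => ((1 + ‖y‖ ^ 2) ^ N : ℝ)⁻¹ • g y) := by
    refine hg.norm.mono' (hw.aestronglyMeasurable.smul hg.1) (Eventually.of_forall fun y => ?_)
    rw [norm_smul, Real.norm_of_nonneg (hw0 y)]
    exact (mul_le_mul_of_nonneg_right (hwle y) (norm_nonneg _)).trans (one_mul _).le
  have h2 : Integrable (fun y => ((1 + ‖y‖ ^ 2) ^ N : ℝ)⁻¹ • h y) := by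
    refine hw.mono' (hw.aestronglyMeasurable.smul hr.1) (Eventually.of_forall fun y => ?_)
    rw [norm_smul, Real.norm_of_nonneg (hw0 y)]
    exact (mul_le_mul_of_nonneg_left (hh1 y) (hw0 y)).trans (mul_one _).le
  refine ⟨N, (h1.add h2).congr ?_⟩
  filter_upwards [hfgh] with y hy
  simp only [Pi.add_apply]
  rw [hy, Pi.add_apply, smul_add]

/-! ### The caloric extension of `f = g + h`, `g ∈ L¹`, `h ∈ L^r` -/

/-- The convolution integral `∫ G_t(z) f(x − z) dz` converges absolutely at every point for
`f ∈ Lᵖ`, `1 ≤ p`, `t > 0` (Hölder against `G_t ∈ L^{p'}`). [folklore] -/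
theorem convolutionExistsAt_heatKernel_of_memLp {f : E → F} {p : ℝ≥0∞} (hf : MemLp f p volume)
    (hp : 1 ≤ p) {t : ℝ} (ht : 0 < t) (x : E) :
    ConvolutionExistsAt (heatKernel t) f x (ContinuousLinearMap.lsmul ℝ ℝ) volume := by
  haveI : p.HolderConjugate (ENNReal.conjExponent p) := .conjExponent hp
  have hq : 1 ≤ ENNReal.conjExponent p :=
    ENNReal.HolderConjugate.one_le (ENNReal.conjExponent p) p
  exact convolutionExistsAt_of_memLp (ContinuousLinearMap.lsmul ℝ ℝ)
    (memLp_heatKernel (E := E) ht hq) hf x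

/-- **Linearity on the truncation**: if `f = g + h` a.e. with `g ∈ L¹` and `h ∈ L^r`, `1 ≤ r`,
then `e^{tΔ}f = e^{tΔ}g + e^{tΔ}h` everywhere on `t > 0` (the caloric extension only sees the
a.e.-class of the datum, and both convolution integrals converge). [folklore] -/
theorem heatExtension_eq_add_of_ae_eq_add {f g h : E → F} (hfgh : f =ᵐ[volume] g + h)
    (hg : Integrable g) {r : ℝ≥0∞} (hr : 1 ≤ r) (hh : MemLp h r volume) {t : ℝ} (ht : 0 < t) :
    heatExtension f t = fun x => heatExtension g t x + heatExtension h t x := by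
  rw [heatExtension_congr_ae' hfgh t]
  funext x
  exact ConvolutionExistsAt.distrib_add
    (convolutionExistsAt_heatKernel_of_memLp (memLp_one_iff_integrable.2 hg) le_rfl ht x)
    (convolutionExistsAt_heatKernel_of_memLp hh hr ht x)

/-! ### Smoothness and the heat equation -/

section WeakLp

variable [CompleteSpace F]

omit [CompleteSpace F] in
/-- **Joint smoothness** ([BT1], proof of Lemma 3.4: "Inclusion in `C¹` comes from the smoothing
effect of the heat kernel"): for weak-`Lᵖ` data, `1 < p < ∞`, `(t, x) ↦ e^{tΔ}f(x)` is `C^∞` on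
`(0, ∞) × E` (sum of the two `C^∞` caloric extensions of the truncation). [cite: BradshawTsai2017AHP, Lemma 3.4 (proof)] -/
theorem _root_.Literature.Analysis.FunctionSpaces.MemWeakLp.contDiffOn_heatExtension_prod
    {f : E → F} {p : ℝ≥0∞} (hf : MemWeakLp f p volume) (hp1 : 1 < p) (hp : p ≠ ∞) :
    ContDiffOn ℝ (⊤ : ℕ∞) (fun q : ℝ × E => heatExtension f q.1 q.2) (Ioi 0 ×ˢ univ) := by
  obtain ⟨g, h, hfgh, hg, hh, -⟩ := hf.exists_integrable_add_bounded hp1 hp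
  have hr : MemLp h (p + 1) volume :=
    hh (p + 1) (ENNReal.lt_add_right hp one_ne_zero) (ENNReal.add_ne_top.2 ⟨hp, ENNReal.one_ne_top⟩)
  have hr1 : 1 ≤ p + 1 := le_add_self
  have hG := UnboundedOperators.contDiffOn_heatExtension_prod (memLp_one_iff_integrable.2 hg) le_rfl
  have hH := UnboundedOperators.contDiffOn_heatExtension_prod hr hr1
  refine (hG.add hH).congr fun q hq => ?_
  have hq1 : 0 < q.1 := (mem_prod.1 hq).1
  have := congrFun (heatExtension_eq_add_of_ae_eq_add hfgh hg hr1 hr hq1) q.2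
  simpa using this

/-- **Smooth slices**: for weak-`Lᵖ` data, `1 < p < ∞`, and `t > 0`, `e^{tΔ}f ∈ C^∞(E; F)`. [cite: BradshawTsai2017AHP, Lemma 3.4 (proof)] -/
theorem _root_.Literature.Analysis.FunctionSpaces.MemWeakLp.contDiff_heatExtension {f : E → F}
    {p : ℝ≥0∞} (hf : MemWeakLp f p volume) (hp1 : 1 < p) (hp : p ≠ ∞) {t : ℝ} (ht : 0 < t) :
    ContDiff ℝ (⊤ : ℕ∞) (heatExtension f t) := by
  obtain ⟨g, h, hfgh, hg, hh, -⟩ := hf.exists_integrable_add_bounded hp1 hp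
  have hr : MemLp h (p + 1) volume :=
    hh (p + 1) (ENNReal.lt_add_right hp one_ne_zero) (ENNReal.add_ne_top.2 ⟨hp, ENNReal.one_ne_top⟩)
  have hr1 : 1 ≤ p + 1 := le_add_self
  rw [heatExtension_eq_add_of_ae_eq_add hfgh hg hr1 hr ht]
  exact (contDiff_heatExtension_holds (memLp_one_iff_integrable.2 hg) le_rfl ht).add
    (contDiff_heatExtension_holds hr hr1 ht)

/-- **The heat equation** for the caloric extension of weak-`Lᵖ` data (`1 < p < ∞`, `F`
complete): for `t > 0` and every `x`, `τ ↦ e^{τΔ}f(x)` has derivative `Δ(e^{tΔ}f)(x)` at `t`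
([BT1]: "`e^{tΔ}v₀` is the … solution to the heat equation"; sum of the heat equations of the two
pieces, `hasDerivAt_heatExtension_time`). [cite: BradshawTsai2017AHP, Lemma 3.4 (proof)] -/
theorem _root_.Literature.Analysis.FunctionSpaces.MemWeakLp.hasDerivAt_heatExtension_time
    {F' : Type*} [NormedAddCommGroup F'] [InnerProductSpace ℝ F'] [CompleteSpace F']
    {f : E → F'} {p : ℝ≥0∞} (hf : MemWeakLp f p volume) (hp1 : 1 < p) (hp : p ≠ ∞) {t : ℝ}
    (ht : 0 < t) (x : E) :
    HasDerivAt (fun τ => heatExtension f τ x) ((Δ (heatExtension f t)) x) t := by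
  obtain ⟨g, h, hfgh, hg, hh, -⟩ := hf.exists_integrable_add_bounded hp1 hp
  have hr : MemLp h (p + 1) volume :=
    hh (p + 1) (ENNReal.lt_add_right hp one_ne_zero) (ENNReal.add_ne_top.2 ⟨hp, ENNReal.one_ne_top⟩)
  have hr1 : 1 ≤ p + 1 := le_add_self
  have hg1 : MemLp g 1 volume := memLp_one_iff_integrable.2 hg
  have hG := UnboundedOperators.hasDerivAt_heatExtension_time ht hg1 le_rfl x
  have hH := UnboundedOperators.hasDerivAt_heatExtension_time ht hr hr1 x
  -- the Laplacian of the sum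
  have hsum : heatExtension f t = heatExtension g t + heatExtension h t := by
    rw [heatExtension_eq_add_of_ae_eq_add hfgh hg hr1 hr ht]; rfl
  have hlap : (Δ (heatExtension f t)) x =
      (Δ (heatExtension g t)) x + (Δ (heatExtension h t)) x := by
    rw [hsum]
    exact ContDiffAt.laplacian_add
      (contDiff_infty.1 (contDiff_heatExtension_holds hg1 le_rfl ht) 2).contDiffAt
      (contDiff_infty.1 (contDiff_heatExtension_holds hr hr1 ht) 2).contDiffAt
  rw [hlap]
  refine (hG.add hH).congr_of_eventuallyEq ?_
  filter_upwards [Ioi_mem_nhds ht] with τ hτ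
  exact congrFun (heatExtension_eq_add_of_ae_eq_add hfgh hg hr1 hr hτ) x

end WeakLp

/-! ### Divergence -/

/-- **The caloric extension of weakly divergence-free weak-`Lᵖ` data is divergence free**
(`1 < p < ∞`, `t > 0`; [BT1] proof of Lemma 3.4: "Since `v₀` is divergence free …, `e^{tΔ}v₀`
is the divergence free … solution to the heat equation"): weakly divergence free by
`isWeaklyDivFree_heatExtension` (weak-`Lᵖ` data are tempered), classically so since the slice
is `C¹` (`IsWeaklyDivFree.isDivFree_of_contDiff`). [cite: BradshawTsai2017AHP, Lemma 3.4 (proof)] -/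
theorem _root_.Literature.Analysis.FunctionSpaces.MemWeakLp.isDivFree_heatExtension {f : E → E}
    {p : ℝ≥0∞} (hf : MemWeakLp f p volume) (hp1 : 1 < p) (hp : p ≠ ∞)
    (hdiv : IsWeaklyDivFree f) {t : ℝ} (ht : 0 < t) :
    VectorCalculus.IsDivFree (heatExtension f t) := by
  haveI : CompleteSpace E := FiniteDimensional.complete ℝ E
  have hw : IsWeaklyDivFree (fun x => heatExtension f t x) :=
    isWeaklyDivFree_heatExtension hdiv (hf.isPolynomiallyTempered hp1 hp) ht
  exact hw.isDivFree_of_contDiff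
    ((hf.contDiff_heatExtension hp1 hp ht).of_le (by exact_mod_cast le_top))

/-! ### `L^q` bounds and uniform tails on compact time ranges -/

section Bounds

variable [CompleteSpace F]

/-- The `Lᵖ → L^q` bound made uniform on `[t₀, ∞)`: for `1 ≤ p ≤ q ≤ ∞` and `t₀ > 0` there is a
finite `A` with `‖e^{tΔ}f‖_q ≤ A‖f‖_p` for all `f ∈ Lᵖ` and all `t ≥ t₀`
(`eLpNorm_heatExtension_le_rpow_holds` and `t^{-a} ≤ t₀^{-a}`). [folklore] -/
theorem exists_forall_eLpNorm_heatExtension_le_mul {p q : ℝ≥0∞} (hp : 1 ≤ p) (hpq : p ≤ q)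
    {t₀ : ℝ} (ht₀ : 0 < t₀) :
    ∃ A : ℝ≥0∞, A ≠ ⊤ ∧ ∀ (f : E → F), MemLp f p volume → ∀ t : ℝ, t₀ ≤ t →
      eLpNorm (heatExtension f t) q volume ≤ A * eLpNorm f p volume := by
  have hp0 : p ≠ 0 := (zero_lt_one.trans_le hp).ne'
  obtain ⟨C, hC⟩ := eLpNorm_heatExtension_le_rpow_holds (E := E) (F := F) hp hpq
  set a : ℝ := (Module.finrank ℝ E : ℝ) / 2 * ((1 / p).toReal - (1 / q).toReal) with ha
  have ha0 : 0 ≤ a := smoothing_exponent_nonneg (E := E) hp0 hpq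
  refine ⟨(C : ℝ≥0∞) * ENNReal.ofReal (t₀ ^ (-a)),
    ENNReal.mul_ne_top ENNReal.coe_ne_top ENNReal.ofReal_ne_top, fun f hf t ht => ?_⟩
  have htpos : 0 < t := ht₀.trans_le ht
  refine (hC f hf t htpos).trans ?_
  gcongr
  rw [show -((Module.finrank ℝ E : ℝ) / 2) * ((1 / p).toReal - (1 / q).toReal) = -a by
    rw [ha]; ring]
  exact Real.rpow_le_rpow_of_nonpos ht₀ ht (neg_nonpos.2 ha0)

/-- A finite exponent strictly between `p` and `q`: for `p < q`, `p ≠ ∞`, the exponent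
`r = min q (p + 1)` satisfies `p < r ≤ q`, `r ≠ ∞`. [folklore] -/
theorem exists_exponent_between {p q : ℝ≥0∞} (hpq : p < q) (hp : p ≠ ∞) :
    ∃ r : ℝ≥0∞, p < r ∧ r ≤ q ∧ r ≠ ∞ :=
  ⟨min q (p + 1), lt_min hpq (ENNReal.lt_add_right hp one_ne_zero), min_le_left _ _,
    ne_top_of_le_ne_top (ENNReal.add_ne_top.2 ⟨hp, ENNReal.one_ne_top⟩) (min_le_right _ _)⟩

/-- **`L^∞(t₀, ∞; L^q)` bound** ([BT1] Lemma 3.4: "`U₀ ∈ L^∞(0,T; L^q(ℝ³))`", with Lemma 3.2):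
for weak-`Lᵖ` data `f`, `1 < p < ∞`, every `q ∈ (p, ∞]` and `t₀ > 0` there is a finite `M` with
`‖e^{tΔ}f‖_{L^q} ≤ M` for all `t ≥ t₀` (`‖e^{tΔ}g‖_q ≤ A₁‖g‖₁`, `‖e^{tΔ}h‖_q ≤ A₂‖h‖_r`,
`p < r ≤ q`). [cite: BradshawTsai2017AHP, Lemma 3.4 (proof)] -/
theorem _root_.Literature.Analysis.FunctionSpaces.MemWeakLp.exists_forall_eLpNorm_heatExtension_le
    {f : E → F} {p : ℝ≥0∞} (hf : MemWeakLp f p volume) (hp1 : 1 < p) (hp : p ≠ ∞) {q : ℝ≥0∞}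
    (hpq : p < q) {t₀ : ℝ} (ht₀ : 0 < t₀) :
    ∃ M : ℝ≥0∞, M ≠ ⊤ ∧ ∀ t : ℝ, t₀ ≤ t → eLpNorm (heatExtension f t) q volume ≤ M := by
  obtain ⟨g, h, hfgh, hg, hh, -⟩ := hf.exists_integrable_add_bounded hp1 hp
  obtain ⟨r, hpr, hrq, hr⟩ := exists_exponent_between hpq hp
  have hr1 : 1 ≤ r := hp1.le.trans hpr.le
  have hq1 : (1 : ℝ≥0∞) ≤ q := hp1.le.trans hpq.le
  have hg1 : MemLp g 1 volume := memLp_one_iff_integrable.2 hg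
  have hhr : MemLp h r volume := hh r hpr hr
  obtain ⟨A₁, hA₁, hA₁b⟩ := exists_forall_eLpNorm_heatExtension_le_mul (E := E) (F := F) le_rfl hq1 ht₀
  obtain ⟨A₂, hA₂, hA₂b⟩ := exists_forall_eLpNorm_heatExtension_le_mul (E := E) (F := F) hr1 hrq ht₀
  refine ⟨A₁ * eLpNorm g 1 volume + A₂ * eLpNorm h r volume,
    ENNReal.add_ne_top.2 ⟨ENNReal.mul_ne_top hA₁ hg1.eLpNorm_ne_top,
      ENNReal.mul_ne_top hA₂ hhr.eLpNorm_ne_top⟩, fun t ht => ?_⟩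
  have htpos : 0 < t := ht₀.trans_le ht
  have hsum : heatExtension f t = heatExtension g t + heatExtension h t := by
    rw [heatExtension_eq_add_of_ae_eq_add hfgh hg hr1 hhr htpos]; rfl
  rw [hsum]
  refine (eLpNorm_add_le
    (contDiff_heatExtension_holds hg1 le_rfl htpos).continuous.aestronglyMeasurable
    (contDiff_heatExtension_holds hhr hr1 htpos).continuous.aestronglyMeasurable hq1).trans ?_
  exact add_le_add (hA₁b g hg1 t ht) (hA₂b h hhr t ht)

/-- **[BT1] Lemma 3.2 for weak-`Lᵖ` data: uniform-in-time decay at spatial infinity.** For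
weak-`Lᵖ` data `f`, `1 < p < ∞`, `q ∈ (p, ∞]`, `0 < t₀ ≤ t₁` and every `ε > 0` there is `R₀`
with `‖e^{tΔ}f‖_{L^q(|x| ≥ R)} ≤ ε` for all `R ≥ R₀` and all `t ∈ [t₀, t₁]` (printed:
"`sup_{1≤t≤λ²} ‖V₀(t)‖_{L^q(|x|>R)} ≤ Θ(R)` … `Θ(R) → 0` as `R → ∞`", for DSS data in `L³_w`).
Proof by truncation `f = g + h` and the `Lᵖ`-data tail lemma for each piece. [cite: BradshawTsai2017AHP, Lemma 3.2] -/
theorem _root_.Literature.Analysis.FunctionSpaces.MemWeakLp.exists_forall_eLpNorm_heatExtension_restrict_compl_ball_le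
    {f : E → F} {p : ℝ≥0∞} (hf : MemWeakLp f p volume) (hp1 : 1 < p) (hp : p ≠ ∞) {q : ℝ≥0∞}
    (hpq : p < q) {t₀ t₁ : ℝ} (ht₀ : 0 < t₀) (h01 : t₀ ≤ t₁) {ε : ℝ≥0∞} (hε : 0 < ε) :
    ∃ R₀ : ℝ, ∀ R, R₀ ≤ R → ∀ t ∈ Icc t₀ t₁,
      eLpNorm (heatExtension f t) q (volume.restrict (ball (0 : E) R)ᶜ) ≤ ε := by
  obtain ⟨g, h, hfgh, hg, hh, -⟩ := hf.exists_integrable_add_bounded hp1 hp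
  obtain ⟨r, hpr, hrq, hr⟩ := exists_exponent_between hpq hp
  have hr1 : 1 ≤ r := hp1.le.trans hpr.le
  have hq1 : (1 : ℝ≥0∞) ≤ q := hp1.le.trans hpq.le
  have hg1 : MemLp g 1 volume := memLp_one_iff_integrable.2 hg
  have hhr : MemLp h r volume := hh r hpr hr
  have hε2 : 0 < ε / 2 := ENNReal.half_pos hε.ne'
  obtain ⟨R₁, hR₁⟩ := UnboundedOperators.exists_forall_eLpNorm_heatExtension_restrict_compl_ball_le
    le_rfl ENNReal.one_ne_top hq1 hg1 ht₀ h01 hε2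
  obtain ⟨R₂, hR₂⟩ := UnboundedOperators.exists_forall_eLpNorm_heatExtension_restrict_compl_ball_le
    hr1 hr hrq hhr ht₀ h01 hε2
  refine ⟨max R₁ R₂, fun R hR t ht => ?_⟩
  have htpos : 0 < t := ht₀.trans_le ht.1
  have hsum : heatExtension f t = heatExtension g t + heatExtension h t := by
    rw [heatExtension_eq_add_of_ae_eq_add hfgh hg hr1 hhr htpos]; rfl
  rw [hsum]
  refine (eLpNorm_add_le
    (contDiff_heatExtension_holds hg1 le_rfl htpos).continuous.aestronglyMeasurable
    (contDiff_heatExtension_holds hhr hr1 htpos).continuous.aestronglyMeasurable hq1).trans ?_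
  calc eLpNorm (heatExtension g t) q (volume.restrict (ball (0 : E) R)ᶜ) +
        eLpNorm (heatExtension h t) q (volume.restrict (ball (0 : E) R)ᶜ)
      ≤ ε / 2 + ε / 2 := add_le_add (hR₁ R ((le_max_left _ _).trans hR) t ht)
          (hR₂ R ((le_max_right _ _).trans hR) t ht)
    _ = ε := ENNReal.add_halves ε

end Bounds

end Literature.Analysis.FluidPDE

end
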